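import Summits.QuantumFields.BalabanUV.Beta.GAN24.SecondOrderCensusCombination

/-!
# `BalabanUV.Beta.GAN24.VolumeLimitLevelwise` — binder row G-an2-4 ∕ (CONV-C), routes C-R6° («VALUES») × R7 («TWO CURRENCIES»), PART 212:
# THE LEVEL-WISE `ℤ^d` END — infinite-volume limits `Π_k` at EVERY level with k-UNIFORM decay (UD) and the closed step bound, for an input bundle of ANY step ratio `θ ≥ 0`
# (no `θ < 1`): the half of PART 140's END that survives when the step rate is not geometric — the currency in which census V202′ (b) (BOUNDED, non-Lipschitz backgrounds such
# as the indicator 1-forms) can be typed; and the trivial step clause `θ = 1` from (UD) alone (unit b2b-balaban-gan24-p3, gen 63; v1)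

NOT IN PRINT; OUR PROOF ([folklore] bookkeeping BY NAME over PART 133 (`uniformDecay_of_isInfiniteVolumeLimit`, `stepRate_of_isInfiniteVolumeLimit`), PART 134 (`window_bounds_of_decay`),
PART 130 (`entryDecay_sub`-type algebra), PART 205 (`castT_zero`); [Balaban1987RG1] (1.20)–(1.22) p. 264 LOCATE the one-loop shapes; nothing printed is a hypothesis).
HONEST FRAMING (cell contract, verbatim): «discharging `BetaPertH` makes Bałaban's UV stability UNCONDITIONAL — a real constructive-QFT result; it is NOT the
continuum limit and NOT the Clay problem.»  HONEST DEPENDENCY (verbatim): «continuum YM on T⁴ ⇐ BetaPertH ∧ nine spine estimates (0/9 proved); BetaPertH ⇐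
(D1) ∧ (D4) ∧ CAP+tail; G-an2-4 gates asym, D1 and NE2/3/4.»

WHY (census V202′ (b)).  For the INDICATOR 1-forms (row an1's coordinate backgrounds) the legs' (L-UD) and the three-point decay hold (PART 198 §3, PART 204 §3 need no smoothness)
but the geometric step envelope (L-SR) is the located analysis item (the left (H-bd) letter is unbounded).  PART 140's socket consumes (UD)+(SR)+(EL) with `θ < 1`.  This file
records what (UD)+(EL) alone give on `ℤ^d` — the limits `Π_k` at every level with `UniformDecay Π μ ν B (δ∕d)` for all `μ, ν` (k-uniform: `B` is the torus constant), and the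
closed step inequality `StepRate Π μ ν B′ (δ∕d) θ` for whatever `θ ≥ 0` the bundle carries (for `θ = 1`: uniformly bounded steps) — and that a bundle with `θ = 1` costs nothing
beyond (UD): `‖c_{k+1} − c_k‖ ≤ 2B·1^k·e^{−δ·dist}`.  `KernelInputs` ∕ the second-moment convergence need `θ < 1` and are NOT concluded.

WHAT THIS FILE PROVES (0 sorry, 0 `def`):
* §1 `twoLevelDecayRate_one_of_entryDecay` — (UD) with `B` at every level ⟹ (SR) with `(2B, δ, θ = 1)`; **`inputs_one_of_ud_of_tendsto`** — (UD) + two-root (EL) ⟹ PART 206's bundle at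
  ratio `1`.
* §2 **`convLevel_of_inputs`** — (`side t → ∞`, `δ ≥ 0`, ANY `θ`) an input bundle `(B, B′, δ, θ)` has limit kernels `Π` with `IsInfiniteVolumeLimit` at every level,
  `UniformDecay Π μ ν B (δ∕d)` and `StepRate Π μ ν B′ (δ∕d) θ` for ALL `μ, ν`; **`convLevel_of_ud_of_tendsto`** — the same from (UD) + two-root (EL) alone (`B′ = 2B`, `θ = 1`).
WHAT IT DOES NOT DO: `KernelInputs`, second moments (need `θ < 1`: PART 140 ∕ 206); any instance (PART 213 ∕ 214).
SUPPLIER work; NEVER «G-an2-4 closed»; NOT (CONV-C), NOT D1, NOT `BetaPertH`, NOT continuum, NOT Clay.  Records: `HOME/b2b-balaban-gan24-p3/gen63/README.md`.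
-/

noncomputable section

open scoped BigOperators ComplexConjugate Matrix Matrix.Norms.L2Operator Kronecker
open Filter Topology Finset Matrix

namespace Summit.QuantumFields.BalabanUV.Beta.GAN24.VolumeLimitLevelwise

open Literature.MathematicalPhysics.QuantumFieldTheory.Balaban1983to89
open Literature.MathematicalPhysics.QuantumFieldTheory.Balaban1983to89.B5Prop11Plancherel (Tor fine)
open Literature.MathematicalPhysics.QuantumFieldTheory.Balaban1983to89.B12Sec2to5 (l1)
open Literature.MathematicalPhysics.QuantumFieldTheory.Balaban1983to89.Beta (Site windowMap IsInfiniteVolumeLimit)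
open Literature.MathematicalPhysics.QuantumFieldTheory.Balaban1983to89.Beta.FreeLegDictionary (cubic)
open Literature.MathematicalPhysics.QuantumFieldTheory.Balaban1983to89.Beta.VectorTails (castT)
open Literature.MathematicalPhysics.QuantumFieldTheory.Balaban1983to89.Beta.LimitRate (StepRate)
open Summit.QuantumFields.BalabanUV.T4Continuum.BalabanAveragedTowerUnit (idx)
open Summit.QuantumFields.BalabanUV.T4Continuum.BalabanAveragedCoerciveTower (unitIdx)
open Summit.QuantumFields.BalabanUV.T4Continuum.CTKingTowerWeights (distK)
open Summit.QuantumFields.BalabanUV.T4Continuum.DecayRateInterpolation (EntryDecay TwoLevelDecayRate)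
open Summit.QuantumFields.BalabanUV.Beta.GAN24.DiagramDecayAlgebra (entryDecay_neg entryDecay_add)
open Summit.QuantumFields.BalabanUV.Beta.GAN24.DiagramDecayZdSocket (stepRate_of_isInfiniteVolumeLimit uniformDecay_of_isInfiniteVolumeLimit)
open Summit.QuantumFields.BalabanUV.Beta.GAN24.DiagramDecayWindow (window_bounds_of_decay)
open Summit.QuantumFields.BalabanUV.Beta.GAN24.TwoVertexWordContraction (castT_zero)

variable {d : ℕ} (L : ℕ) [NeZero L]

/-! ## §1 The trivial step clause: a bundle at ratio `1` from (UD) and (EL) alone -/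

section One

variable {n : Type*} [Fintype n] [DecidableEq n] {dist : n → n → ℝ}

omit [Fintype n] [DecidableEq n] in
/-- **(UD) at every level ⟹ (SR) at ratio `1` with `2B`**: `‖(c_{k+1} − c_k)(x,y)‖ ≤ ‖c_{k+1}(x,y)‖ + ‖c_k(x,y)‖`. [folklore] -/
theorem twoLevelDecayRate_one_of_entryDecay {c : ℕ → Matrix n n ℂ} {B δ : ℝ} (h : ∀ k, EntryDecay dist (c k) B δ) :
    TwoLevelDecayRate dist c (2 * B) δ 1 := by
  intro k x y
  rw [one_pow, mul_one, sub_eq_add_neg]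
  have h' := entryDecay_add (h (k + 1)) (entryDecay_neg (h k)) x y
  simpa only [two_mul] using h'

end One

section Bundle

variable {side : ℕ → ℕ}

omit [NeZero L] in
/-- **`inputs_one_of_ud_of_tendsto` — (UD) + TWO-ROOT (EL) IS AN INPUT BUNDLE AT RATIO `1`** (constants `B`, `2B`). [folklore] -/
theorem inputs_one_of_ud_of_tendsto [∀ t, NeZero (side t)] {c : (t : ℕ) → ℕ → Matrix (idx L (cubic d (side t)) 0) (idx L (cubic d (side t)) 0) ℂ} {B δ : ℝ}
    (hud : ∀ t k, EntryDecay (distK L (cubic d (side t))) (c t k) B δ)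
    (hel : ∀ k (μ ν : Fin d) (z z' : Fin d → ℤ), ∃ s : ℂ, Tendsto (fun t => c t k ((unitIdx L (cubic d (side t))).symm (castT (cubic d (side t)) z, μ))
      ((unitIdx L (cubic d (side t))).symm (castT (cubic d (side t)) z', ν))) atTop (𝓝 s)) :
    (∀ t k, EntryDecay (distK L (cubic d (side t))) (c t k) B δ) ∧ (∀ t, TwoLevelDecayRate (distK L (cubic d (side t))) (c t) (2 * B) δ 1) ∧
      (∀ k (μ ν : Fin d) (z z' : Fin d → ℤ), ∃ s : ℂ, Tendsto (fun t => c t k ((unitIdx L (cubic d (side t))).symm (castT (cubic d (side t)) z, μ))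
        ((unitIdx L (cubic d (side t))).symm (castT (cubic d (side t)) z', ν))) atTop (𝓝 s)) :=
  ⟨hud, fun t => twoLevelDecayRate_one_of_entryDecay (hud t), hel⟩

end Bundle

/-! ## §2 The level-wise END: limits at every level, k-uniform decay, the closed step bound — any ratio -/

section End

variable {side : ℕ → ℕ} [∀ t, NeZero (side t)]

/-- **`convLevel_of_inputs` — THE LEVEL-WISE `ℤ^d` END OF AN INPUT BUNDLE OF ANY RATIO** (`side t → ∞`, `δ ≥ 0`, `θ` arbitrary): a volume-indexed family of towers with
(UD) `(B, δ)`, (SR) `(B′, δ, θ)` and (EL) at all integer root pairs has limit kernels `Π_k` with `IsInfiniteVolumeLimit` at EVERY level, `UniformDecay Π μ ν B (δ∕d)` (k-UNIFORM)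
and `StepRate Π μ ν B′ (δ∕d) θ` for ALL `μ, ν` — PART 134's window dictionary + PART 133's closed-inequality sockets; NO `θ < 1`, hence no `KernelInputs` and no second moments.
[cite: Balaban1987RG1, (1.21)–(1.22) p.264 (shapes)] [folklore] -/
theorem convLevel_of_inputs (hside : Tendsto side atTop atTop)
    {c : (t : ℕ) → ℕ → Matrix (idx L (cubic d (side t)) 0) (idx L (cubic d (side t)) 0) ℂ} {B B' δ θ : ℝ} (hδ : 0 ≤ δ)
    (h : (∀ t k, EntryDecay (distK L (cubic d (side t))) (c t k) B δ) ∧ (∀ t, TwoLevelDecayRate (distK L (cubic d (side t))) (c t) B' δ θ) ∧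
      (∀ k (μ ν : Fin d) (z z' : Fin d → ℤ), ∃ s : ℂ, Tendsto (fun t => c t k ((unitIdx L (cubic d (side t))).symm (castT (cubic d (side t)) z, μ))
        ((unitIdx L (cubic d (side t))).symm (castT (cubic d (side t)) z', ν))) atTop (𝓝 s))) :
    ∃ Pinf : ℕ → B12Beta.Kernel d,
      (∀ k, IsInfiniteVolumeLimit side
        (fun t μ' ν' (z : Site d (side t)) => (c t k ((unitIdx L (cubic d (side t))).symm (z, μ')) ((unitIdx L (cubic d (side t))).symm (0, ν'))).re) (Pinf k)) ∧
      (∀ μ ν, Beta.LimitRate.UniformDecay Pinf μ ν B (δ / d)) ∧ (∀ μ ν, StepRate Pinf μ ν B' (δ / d) θ) := by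
  obtain ⟨hud, hsr, hel⟩ := h
  have hlim : ∀ k (μ ν : Fin d) (z : Fin d → ℤ), ∃ s : ℂ,
      Tendsto (fun t => c t k ((unitIdx L (cubic d (side t))).symm (castT (cubic d (side t)) z, μ)) ((unitIdx L (cubic d (side t))).symm (0, ν))) atTop (𝓝 s) := by
    intro k μ ν z
    obtain ⟨s, hs⟩ := hel k μ ν z 0
    refine ⟨s, hs.congr fun t => ?_⟩
    rw [castT_zero]
  choose s hs using hlim
  refine ⟨fun k μ' ν' z => (s k μ' ν' z).re, ?_⟩
  have hlimre : ∀ k, IsInfiniteVolumeLimit side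
      (fun t μ' ν' (z : Site d (side t)) => (c t k ((unitIdx L (cubic d (side t))).symm (z, μ')) ((unitIdx L (cubic d (side t))).symm (0, ν'))).re)
      (fun μ' ν' z => (s k μ' ν' z).re) :=
    fun k μ' ν' z => (Complex.continuous_re.tendsto _).comp (hs k μ' ν' z)
  have hUDv : ∀ k, Beta.UniformDecay side
      (fun t μ' ν' (z : Site d (side t)) => (c t k ((unitIdx L (cubic d (side t))).symm (z, μ')) ((unitIdx L (cubic d (side t))).symm (0, ν'))).re) B (δ / d) := by
    intro k t μ' ν' z
    have := (window_bounds_of_decay L (side t) hδ (hud t) (hsr t) μ' ν').1 k z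
    simpa only [neg_mul] using this
  have hSRv : ∀ (μ ν : Fin d) k t (z : Site d (side t)),
      |(c t (k + 1) ((unitIdx L (cubic d (side t))).symm (z, μ)) ((unitIdx L (cubic d (side t))).symm (0, ν))).re
        - (c t k ((unitIdx L (cubic d (side t))).symm (z, μ)) ((unitIdx L (cubic d (side t))).symm (0, ν))).re|
        ≤ B' * θ ^ k * Real.exp (-(δ / d) * l1 (windowMap d (side t) z)) :=
    fun μ ν k t z => (window_bounds_of_decay L (side t) hδ (hud t) (hsr t) μ ν).2 k z
  exact ⟨hlimre, fun μ ν => uniformDecay_of_isInfiniteVolumeLimit hside hlimre hUDv μ ν, fun μ ν => stepRate_of_isInfiniteVolumeLimit hside hlimre (hSRv μ ν)⟩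

/-- **`convLevel_of_ud_of_tendsto` — THE LEVEL-WISE END FROM (UD) + TWO-ROOT (EL) ALONE** (`θ = 1`, `B′ = 2B`): infinite-volume limits at every level with k-uniform decay.
[cite: Balaban1987RG1, (1.21)–(1.22) p.264 (shapes)] [folklore] -/
theorem convLevel_of_ud_of_tendsto (hside : Tendsto side atTop atTop)
    {c : (t : ℕ) → ℕ → Matrix (idx L (cubic d (side t)) 0) (idx L (cubic d (side t)) 0) ℂ} {B δ : ℝ} (hδ : 0 ≤ δ)
    (hud : ∀ t k, EntryDecay (distK L (cubic d (side t))) (c t k) B δ)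
    (hel : ∀ k (μ ν : Fin d) (z z' : Fin d → ℤ), ∃ s : ℂ, Tendsto (fun t => c t k ((unitIdx L (cubic d (side t))).symm (castT (cubic d (side t)) z, μ))
      ((unitIdx L (cubic d (side t))).symm (castT (cubic d (side t)) z', ν))) atTop (𝓝 s)) :
    ∃ Pinf : ℕ → B12Beta.Kernel d,
      (∀ k, IsInfiniteVolumeLimit side
        (fun t μ' ν' (z : Site d (side t)) => (c t k ((unitIdx L (cubic d (side t))).symm (z, μ')) ((unitIdx L (cubic d (side t))).symm (0, ν'))).re) (Pinf k)) ∧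
      (∀ μ ν, Beta.LimitRate.UniformDecay Pinf μ ν B (δ / d)) ∧ (∀ μ ν, StepRate Pinf μ ν (2 * B) (δ / d) 1) :=
  convLevel_of_inputs L hside hδ (inputs_one_of_ud_of_tendsto L hud hel)

end End

end Summit.QuantumFields.BalabanUV.Beta.GAN24.VolumeLimitLevelwise

end
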